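import Summits.BirchSwinnertonDyer.BirchSwinnertonDyer.Theorems.ByReductionTypeAtTwoTowerLayerDuality
import Summits.BirchSwinnertonDyer.Rank1Residual.X2.GreenbergVatsalStrictAtPQuotient
import HarnessLib

/-!
# Greenberg's evaluation map on `A_n[p]`: the EXPLICIT local error terms
# `#A_n[p] ≤ #Sel_{p^∞}(E/K_n)[p] · ∏_{v ∈ S} (#𝒦_{v,n}[p])^{#R_v}`, and the covering sets `R_v`
# (route ByReductionTypeAtTwo, crux `OrdKatoHalfAtTwo`, item stmt-BirchSwinnertonDyer-19271;
# seat bsd-2adic-tower-1, D-0074 (T1) «[2]-level control at p = 2», part 3a)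

HONEST FRAMING (cell `bsd-2adic`, run/shared/lean/pub/bsd-2adic/, HUMAN RULINGS D-0036/D-0074): THEOREMS
ONLY; nothing asserted; no definition; no new named fact; closes nothing by itself. Any prime `p`, any
number field `K`, any `ℤ_p`-extension `κ` (§2's sharp cover: `ℚ`, cyclotomic). The local error terms are
EXPLICIT HYPOTHESES on the tree's local tower kernels `𝒦_{v,n} = W.localTowerKer κ K_v n` (Greenberg's
`ker r_{v_n}`, file `IwasawaSelmerControlLocalizationProofs`); their PRINT values (Greenberg LNM 1716
Lemma 3.3 — `= c_{v_n}^{(p)}` at bad `v ∤ p`, `= 0` at good `v ∤ p` —, Lemma 3.4 — `= |Ẽ(f_{v_n})(p)|²` at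
good ordinary `v ∣ p`) are NOT asserted here.

* §1 `natCard_layerClasses_le_of_localKernelBounds`: Greenberg's evaluation map of Lemma 3.5 (p. 90)
  RESTRICTED TO `p`-TORSION. For a finite set `S` of finite places with `𝒦_{v,n}[p^∞] = 0` off `S`,
  finite sets `R_v ⊆ Γ_K` with `Γ_K = ⋃_{ρ ∈ R_v} D_v ρ Gal(K̄/K_n)` (one `ρ` per prime of `K_n` above
  `v`), and bounds `#𝒦_{v,n}[p] ≤ C_v` on the `p`-TORSION of the local tower kernels:
  **`#A_n[p] ≤ #Sel_{p^∞}(E/K_n)[p] · ∏_{v ∈ S} C_v ^ #R_v`** (the map `y ↦ (loc_v conj_ρ y)` on `A_n[p]`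
  has kernel in `Sel_n[p]`, tree `mem_selmerLayer_of_forall_localResOver_conjH1_eq_zero`, and `p`-torsion
  values). With part 2 (`#X/(p,T^{pⁿ})X = #A_n[p]`): `natCard_quotient_towerIdeal_le_of_localKernelBounds`
  — the UPPER bound a tower-gap certificate needs, from a layer Selmer count and local kernel counts.
* §2 covering sets: `exists_cover_of_layerSubgroup` (any place: a left transversal of `Gal(K̄/K_n)`,
  `#R_v = pⁿ`, crude) and, over `ℚ` for the cyclotomic tower at `v ∋ p` (totally ramified:
  `κ(I_v) = ℤ_p`, tree `X2.GreenbergVatsalStrictAtPQuotient.exists_mem_inertia_kappa_eq`),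
  `cover_singleton_at_p`: **`R_v = {1}`** — the local factor at `p` enters ONCE at every layer.

The `p = 2` gap bridge and doors consuming this are part 3b (`…TowerLayerGap.lean`).

References: R. Greenberg, LNM 1716 (1999), §3 pp. 85–90 (Lemmas 3.1–3.5); L. Washington,
*Introduction to Cyclotomic Fields*, §13.1–13.2; J.-P. Serre, *Local Fields*, IV §4.
-/

set_option autoImplicit false

noncomputable section

open scoped Classical MatrixGroups ModularForm

open NumberField IsDedekindDomain CongruenceSubgroup WeierstrassCurve Literature.NumberTheory.EllipticCurves
  Literature.NumberTheory.EllipticCurves.ModularForms Literature.NumberTheory.EllipticCurves.Rank1Residual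
  Literature.NumberTheory.EllipticCurves.Rank1Residual.Typed
  Literature.NumberTheory.EllipticCurves.Greenberg1999
  Summit.BirchSwinnertonDyer.Rank1Residual.X1.MuLambda
  Summit.BirchSwinnertonDyer.Rank1Residual.X1.MuPart
  Summit.BirchSwinnertonDyer.Rank1Residual.X1.ParitySqueeze
  Summit.BirchSwinnertonDyer.BirchSwinnertonDyer.Theorems.Rank1ResidualX1Defs
  Summit.BirchSwinnertonDyer.Rank1Residual.X5 Summit.BirchSwinnertonDyer.Rank1Residual.X5.O1
  Summit.BirchSwinnertonDyer.Rank1Residual.X5.TowerGap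
  Summit.BirchSwinnertonDyer.Rank1Residual

universe u

namespace Summit.BirchSwinnertonDyer.BirchSwinnertonDyer.Theorems.TowerLayer

/-! ## §1 Greenberg's evaluation map on `A_n[p]` -/

/-- Bookkeeping: an element of a subgroup killed by `m` in the ambient group is killed by `m` in the
subgroup. [folklore] -/
theorem nsmul_mk_eq_zero {G : Type*} [AddCommGroup G] (H : AddSubgroup G) {x : G} (hx : x ∈ H)
    {m : ℕ} (h : m • x = 0) : m • (⟨x, hx⟩ : H) = 0 :=
  Subtype.ext (by rw [AddSubgroup.coe_nsmul, AddSubgroup.coe_zero]; exact h)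

section Local

variable {K : Type u} [Field K] [NumberField K] (W : WeierstrassCurve K) {p : ℕ} [hp : Fact p.Prime]
  (κ : ZpExtension K p) {γ : Field.absoluteGaloisGroup K}

/-- **`#A_n[p] ≤ #Sel_{p^∞}(E/K_n)[p] · ∏_{v ∈ S} C_v ^ #R_v` (Greenberg's Lemma 3.5 mechanism on
`p`-torsion).** Let `S` be a finite set of finite places such that the `p`-power torsion
`𝒦_{v,n}[p^∞]` of the local tower kernel vanishes for `v ∉ S` (good `v ∤ p`: Lemma 3.3), let
`R_v` (`v ∈ S`) be finite sets with `Γ_K = ⋃_{ρ ∈ R_v} D_v ρ Gal(K̄/K_n)` (one element per prime of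
`K_n` above `v` suffices), and let `C_v` bound the number of `p`-TORSION classes of `𝒦_{v,n}`. Then the
evaluation map `y ↦ (loc_v (conj_ρ y))_{v ∈ S, ρ ∈ R_v}` on `A_n[p]`, `A_n = h_n⁻¹(Sel_{p^∞}(E/K_∞))`,
has kernel inside `Sel_{p^∞}(E/K_n)[p]` (tree `mem_selmerLayer_of_forall_localResOver_conjH1_eq_zero`;
archimedean places split completely) and `p`-torsion values in `∏ 𝒦_{v,n}[p]`, whence the bound
(when `Sel_{p^∞}(E/K_n)[p]` is finite). [cite: GreenbergLNM1716, §3 Lemma 3.5 (proof, p. 90)] -/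
theorem natCard_layerClasses_le_of_localKernelBounds {n : ℕ}
    (S : Finset (HeightOneSpectrum (𝓞 K))) (C : HeightOneSpectrum (𝓞 K) → ℕ)
    (R : HeightOneSpectrum (𝓞 K) → Finset (Field.absoluteGaloisGroup K))
    (h0 : ∀ v ∉ S, W.localTowerKerPrimary κ (v.adicCompletion K) n = ⊥)
    (hC : ∀ v ∈ S, Finite {x : W.localTowerKerPrimary κ (v.adicCompletion K) n // p • x = 0} ∧
      Nat.card {x : W.localTowerKerPrimary κ (v.adicCompletion K) n // p • x = 0} ≤ C v)
    (hR : ∀ v ∈ S, ∀ σ : Field.absoluteGaloisGroup K, ∃ ρ ∈ R v,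
      ∃ δ : Field.absoluteGaloisGroup (v.adicCompletion K), ∃ τ ∈ κ.layerSubgroup n,
        σ = resGal (K := K) (v.adicCompletion K) δ * ρ * τ)
    (hfin : Finite {z : W.selmerLayer κ n // p • z = 0}) :
    Nat.card {z : W.selmerInftyPreimage κ n // p • z = 0} ≤
      Nat.card {z : W.selmerLayer κ n // p • z = 0} * ∏ v ∈ S, C v ^ (R v).card := by
  set A := W.selmerInftyPreimage κ n with hA
  set I : Finset ((_ : HeightOneSpectrum (𝓞 K)) × Field.absoluteGaloisGroup K) :=
    S.sigma fun v ↦ R v with hI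
  have hIv : ∀ i : ↥I, i.1.1 ∈ S := fun i ↦ (Finset.mem_sigma.mp i.2).1
  -- the evaluation map on `A_n`
  let Φ : ↥A →+ (Π i : ↥I, discreteH1 (localSubgroup (κ.layerSubgroup n) (i.1.1.adicCompletion K))
      (localPoints W (i.1.1.adicCompletion K))) :=
    AddMonoidHom.pi fun i ↦
      ((W.localResOver p (κ.layerSubgroup n) (i.1.1.adicCompletion K)).comp
        (W.conjH1 p (κ.layerSubgroup n) i.1.2)).comp A.subtype
  have hΦ : ∀ (y : ↥A) (i : ↥I), Φ y i = W.localResOver p (κ.layerSubgroup n)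
      (i.1.1.adicCompletion K) (W.conjH1 p (κ.layerSubgroup n) i.1.2 (y : W.subgroupH1 p _)) :=
    fun y i ↦ rfl
  -- restricted to the `p`-torsion `P = A_n[p]`
  let P : AddSubgroup ↥A := AddSubgroup.torsionBy ↥A (p : ℤ)
  have hPmem : ∀ z : ↥A, z ∈ P ↔ p • z = 0 := fun z ↦ AddSubgroup.torsionBy.nsmul_iff
  have hPcoe : ∀ z : ↥P, p • ((z : ↥A) : W.subgroupH1 p (κ.layerSubgroup n)) = 0 := fun z ↦ by
    rw [← AddSubgroup.coe_nsmul, (hPmem _).mp z.2, AddSubgroup.coe_zero]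
  let ΦP : ↥P →+ _ := Φ.comp P.subtype
  have hΦP : ∀ z : ↥P, ΦP z = Φ (z : ↥A) := fun _ ↦ rfl
  -- (1) the kernel lies in `Sel_n[p]`
  have hker_sel : ∀ z : ↥P, ΦP z = 0 →
      ((z : ↥A) : W.subgroupH1 p (κ.layerSubgroup n)) ∈ W.selmerLayer κ n := by
    intro z hz
    refine W.mem_selmerLayer_of_forall_localResOver_conjH1_eq_zero κ S h0 R
      (fun v hv σ ↦ hR v hv σ) (z : ↥A).2 fun v hv ρ hρ ↦ ?_
    have := congrFun hz ⟨⟨v, ρ⟩, Finset.mem_sigma.mpr ⟨hv, hρ⟩⟩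
    rw [hΦP, hΦ] at this
    exact this
  let kerToSel : ↥ΦP.ker → {z : W.selmerLayer κ n // p • z = 0} := fun z ↦
    ⟨⟨((z.1 : ↥A) : W.subgroupH1 p (κ.layerSubgroup n)), hker_sel z.1 z.2⟩,
      nsmul_mk_eq_zero _ _ (hPcoe z.1)⟩
  have hkerToSel_val : ∀ z : ↥ΦP.ker,
      (((kerToSel z).1 : ↥(W.selmerLayer κ n)) : W.subgroupH1 p (κ.layerSubgroup n)) =
        ((z.1 : ↥A) : W.subgroupH1 p (κ.layerSubgroup n)) := fun _ ↦ rfl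
  have hkerToSel : Function.Injective kerToSel := by
    intro z z' h
    have h' : (((kerToSel z).1 : ↥(W.selmerLayer κ n)) : W.subgroupH1 p (κ.layerSubgroup n)) =
        (((kerToSel z').1 : ↥(W.selmerLayer κ n)) : W.subgroupH1 p (κ.layerSubgroup n)) := by
      rw [h]
    rw [hkerToSel_val, hkerToSel_val] at h'
    exact Subtype.ext (Subtype.ext (Subtype.ext h'))
  -- (2) the values are `p`-torsion classes of the local tower kernels
  have hval : ∀ (z : ↥P) (i : ↥I),
      ΦP z i ∈ W.localTowerKerPrimary κ (i.1.1.adicCompletion K) n ∧ p • ΦP z i = 0 := by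
    intro z i
    have hpz : p • ΦP z i = 0 := by
      rw [hΦP, hΦ, ← map_nsmul, ← map_nsmul, hPcoe z, map_zero, map_zero]
    exact ⟨⟨by rw [hΦP, hΦ]; exact W.localResOver_conjH1_mem_localTowerKer_of_mem κ (z : ↥A).2 _ _,
      1, by rw [pow_one]; exact hpz⟩, hpz⟩
  haveI hfinK : ∀ i : ↥I,
      Finite {x : W.localTowerKerPrimary κ (i.1.1.adicCompletion K) n // p • x = 0} :=
    fun i ↦ (hC _ (hIv i)).1
  have hval' : ∀ (x : ΦP.range) (i : ↥I),
      x.1 i ∈ W.localTowerKerPrimary κ (i.1.1.adicCompletion K) n ∧ p • x.1 i = 0 := by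
    rintro ⟨x, z, rfl⟩ i
    exact hval z i
  let g : ΦP.range → Π i : ↥I,
      {x : W.localTowerKerPrimary κ (i.1.1.adicCompletion K) n // p • x = 0} := fun x i ↦
    ⟨⟨x.1 i, (hval' x i).1⟩, nsmul_mk_eq_zero _ _ (hval' x i).2⟩
  have hg_val : ∀ (x : ΦP.range) (i : ↥I),
      (((g x i).1 : W.localTowerKerPrimary κ (i.1.1.adicCompletion K) n) :
        discreteH1 (localSubgroup (κ.layerSubgroup n) (i.1.1.adicCompletion K))
          (localPoints W (i.1.1.adicCompletion K))) = x.1 i := fun _ _ ↦ rfl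
  have hg : Function.Injective g := by
    intro x x' h
    refine Subtype.ext (funext fun i ↦ ?_)
    rw [← hg_val x i, ← hg_val x' i, h]
  haveI : Finite ΦP.range := Finite.of_injective g hg
  have hcard_range : Nat.card ΦP.range ≤ ∏ v ∈ S, C v ^ (R v).card :=
    calc Nat.card ΦP.range
        ≤ Nat.card (Π i : ↥I,
            {x : W.localTowerKerPrimary κ (i.1.1.adicCompletion K) n // p • x = 0}) :=
          Nat.card_le_card_of_injective g hg
      _ = ∏ i : ↥I, Nat.card
            {x : W.localTowerKerPrimary κ (i.1.1.adicCompletion K) n // p • x = 0} := Nat.card_pi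
      _ ≤ ∏ i : ↥I, C i.1.1 :=
          Finset.prod_le_prod (fun i _ ↦ Nat.zero_le _) fun i _ ↦ (hC _ (hIv i)).2
      _ = ∏ i ∈ I, C i.1 := Finset.prod_coe_sort I (fun i ↦ C i.1)
      _ = ∏ v ∈ S, ∏ ρ ∈ R v, C v := Finset.prod_sigma S (fun v ↦ R v) (fun i ↦ C i.1)
      _ = ∏ v ∈ S, C v ^ (R v).card := Finset.prod_congr rfl fun v _ ↦ Finset.prod_const (C v)
  -- (3) count
  haveI : Finite ΦP.ker := Finite.of_injective kerToSel hkerToSel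
  have hP : Nat.card ↥P = Nat.card (↥P ⧸ ΦP.ker) * Nat.card ΦP.ker :=
    AddSubgroup.card_eq_card_quotient_mul_card_addSubgroup _
  have hq : Nat.card (↥P ⧸ ΦP.ker) = Nat.card ΦP.range :=
    Nat.card_congr (QuotientAddGroup.quotientKerEquivRange ΦP).toEquiv
  have hker_le : Nat.card ΦP.ker ≤ Nat.card {z : W.selmerLayer κ n // p • z = 0} :=
    Nat.card_le_card_of_injective kerToSel hkerToSel
  have hPA : Nat.card {z : W.selmerInftyPreimage κ n // p • z = 0} = Nat.card ↥P :=
    Nat.card_congr (Equiv.subtypeEquivRight fun z ↦ (hPmem z).symm)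
  rw [hPA, hP, hq, mul_comm]
  exact Nat.mul_le_mul hker_le hcard_range

/-- **`#X/(p, T^{pⁿ})X ≤ #Sel_{p^∞}(E/K_n)[p] · ∏_{v ∈ S} C_v ^ #R_v`** — part 2's finite-layer count
(`#X/(p, T^{pⁿ})X = #A_n[p]`, `E(K)[p] = 0`, `γ` a topological generator, `X` finitely generated)
combined with the evaluation map on `A_n[p]`. This is the UPPER bound a tower-gap certificate needs:
layer-`n` Selmer count + local kernel counts. [cite: GreenbergLNM1716, §3 pp. 85–90] -/
theorem natCard_quotient_towerIdeal_le_of_localKernelBounds [W.IsElliptic] (D : W.SelmerDualData κ γ)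
    [Module.Finite (IwasawaAlgebra p) D.X] (hγ : κ.IsTopGenerator γ)
    (hK : ∀ P : W.toAffine.Point, p • P = 0 → P = 0) {n : ℕ}
    (S : Finset (HeightOneSpectrum (𝓞 K))) (C : HeightOneSpectrum (𝓞 K) → ℕ)
    (R : HeightOneSpectrum (𝓞 K) → Finset (Field.absoluteGaloisGroup K))
    (h0 : ∀ v ∉ S, W.localTowerKerPrimary κ (v.adicCompletion K) n = ⊥)
    (hC : ∀ v ∈ S, Finite {x : W.localTowerKerPrimary κ (v.adicCompletion K) n // p • x = 0} ∧
      Nat.card {x : W.localTowerKerPrimary κ (v.adicCompletion K) n // p • x = 0} ≤ C v)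
    (hR : ∀ v ∈ S, ∀ σ : Field.absoluteGaloisGroup K, ∃ ρ ∈ R v,
      ∃ δ : Field.absoluteGaloisGroup (v.adicCompletion K), ∃ τ ∈ κ.layerSubgroup n,
        σ = resGal (K := K) (v.adicCompletion K) δ * ρ * τ) :
    Nat.card (D.X ⧸ (towerIdeal p (p ^ n) • ⊤ : Submodule (IwasawaAlgebra p) D.X)) ≤
      Nat.card {z : W.selmerLayer κ n // p • z = 0} * ∏ v ∈ S, C v ^ (R v).card := by
  rw [natCard_quotient_towerIdeal_eq_natCard_layerClasses W κ D hγ hK n]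
  exact natCard_layerClasses_le_of_localKernelBounds W κ S C R h0 hC hR
    (KatoHalfPinch.finite_and_natCard_selmerLayer_pTorsion_le W κ D hK n).1

/-! ## §2 Covering sets `R_v` -/

omit [NumberField K] in
/-- **A crude cover (any place): a left transversal of `Gal(K̄/K_n)`**, of size `[Γ_K : Gal(K̄/K_n)] = pⁿ`
(`ZpExtension.index_layerSubgroup`): every `σ` is `ρ τ` with `ρ` in the transversal and
`τ ∈ Gal(K̄/K_n)` (take `δ = 1`). [cite: Washington1997, §13.1] -/
theorem exists_cover_of_layerSubgroup (E : Type u) [Field E] [Algebra K E] (n : ℕ) :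
    ∃ R : Finset (Field.absoluteGaloisGroup K), R.card = p ^ n ∧
      ∀ σ : Field.absoluteGaloisGroup K, ∃ ρ ∈ R, ∃ δ : Field.absoluteGaloisGroup E,
        ∃ τ ∈ κ.layerSubgroup n, σ = resGal (K := K) E δ * ρ * τ := by
  haveI : (κ.layerSubgroup n).FiniteIndex :=
    ⟨by rw [ZpExtension.index_layerSubgroup]; exact pow_ne_zero _ hp.out.ne_zero⟩
  obtain ⟨T, hT, -⟩ := Subgroup.exists_isComplement_left (κ.layerSubgroup n) 1
  have hTfin : T.Finite := hT.finite_left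
  refine ⟨hTfin.toFinset, ?_, fun σ ↦ ?_⟩
  · rw [← Set.ncard_eq_toFinset_card T hTfin, hT.ncard_left, ZpExtension.index_layerSubgroup]
  · refine ⟨(hT.toLeftFun σ : Field.absoluteGaloisGroup K), hTfin.mem_toFinset.mpr (hT.toLeftFun σ).2,
      1, (hT.toLeftFun σ : Field.absoluteGaloisGroup K)⁻¹ * σ, hT.inv_toLeftFun_mul_mem σ, ?_⟩
    rw [map_one, one_mul, mul_inv_cancel_left]

/-- **The sharp cover at the prime above `p` of `ℚ` in the cyclotomic tower: `R = {1}`** (`p` is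
totally ramified in `ℚ_∞/ℚ`: `κ(I_v) = ℤ_p`, tree `exists_mem_inertia_kappa_eq`; so every `σ ∈ Γ_ℚ` is
`y τ` with `y ∈ I_v ⊆ D_v = res(Γ_{ℚ_v})` and `κ τ = 1`). There is exactly ONE prime above `p` in every
layer `ℚ_n`, so the local factor at `p` enters ONCE. [cite: Washington1997, §13.1]
[cite: SerreLocalFields1979, Ch. IV §4 Prop. 17] -/
theorem cover_singleton_at_p (κ : ZpExtension ℚ p) (hκ : κ.IsCyclotomic) (v : HeightOneSpectrum (𝓞 ℚ))
    (hpv : ((p : ℕ) : 𝓞 ℚ) ∈ v.asIdeal) (n : ℕ) :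
    ∀ σ : Field.absoluteGaloisGroup ℚ, ∃ ρ ∈ ({1} : Finset (Field.absoluteGaloisGroup ℚ)),
      ∃ δ : Field.absoluteGaloisGroup (v.adicCompletion ℚ), ∃ τ ∈ κ.layerSubgroup n,
        σ = resGal (K := ℚ) (v.adicCompletion ℚ) δ * ρ * τ := by
  intro σ
  obtain ⟨y, hyI, hκy⟩ :=
    X2.GreenbergVatsalStrictAtPQuotient.exists_mem_inertia_kappa_eq κ v hκ hpv (κ σ)
  obtain ⟨δ, hδ⟩ := (GreenbergSelmer.mem_decomp_iff v y).mp (GreenbergSelmer.inertia_le_decomp v hyI)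
  refine ⟨1, Finset.mem_singleton_self _, δ, y⁻¹ * σ, ?_, ?_⟩
  · apply κ.kerSubgroup_le_layerSubgroup n
    rw [ZpExtension.mem_kerSubgroup, map_mul, map_inv, hκy, inv_mul_cancel]
  · rw [mul_one, resGal_eq_absGaloisRestrict, hδ, mul_inv_cancel_left]

end Local

end Summit.BirchSwinnertonDyer.BirchSwinnertonDyer.Theorems.TowerLayer

end
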